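import Literature.NumberTheory.GelbartRogawski1991.LocalWeilRepresentationL2Unitary
import Literature.RepresentationTheory.HeisenbergGroup.SchrodingerL2Irreducible
import HarnessLib

/-!
# The local splitting `s_v : U(J)(F_v) → S̃p_{ψ_v}(𝕎_v)` in the UNITARY model: pairs `(ι_v g, U_g)` over `L²(F_vᴺ)`

Topic `NumberTheory/GelbartRogawski1991`; namespace `Literature.NumberTheory.GelbartRogawski1991.UnitaryDualPair.LocalSplitting`.
KERNEL ONLY: two definitions with bodies (`localSchrodingerL2`, `LocalSplittingDatum.localSplittingL2`) and proved
theorems; no named fact, no record, no `sorry`.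

[GelbartRogawski1991, §3.1 p. 454 L17–36, Prop. 3.1.1 p. 455 L1–3] phrase the metaplectic group `Mp(W)` as the group of
pairs `(g, M_g)`, `g ∈ Sp(W)`, `M_g` a (unitary) operator on the HILBERT SPACE of `ρ_ψ` with `M_g ρ_ψ(h) M_g⁻¹ = ρ_ψ(g h)`,
the local coverings `π_v : Mp_v(W) → Sp_v(W)` "defined similarly" (p. 454 L28–29), and assert that `π` splits over the
unitary group.  The tree's finite-place construction (GR-1/GR-2 lineage: `LocalSplittingDatum`, `localSplitting`,
`localOmega`; modules I–III of `GR1-TREE-MAP`) lives on the SMOOTH model `𝒮(F_vᴺ)`.  This file records the same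
construction in the printed, unitary, setting:

* §1 **`localSchrodingerL2 F N T v μ'`** — the unitary Schrödinger representation `ρ_{ψ_v}` of `H(𝕎_v)` on
  `L²(F_vᴺ, μ'ᴺ)` (`HeisenbergGroup/SchrodingerL2Unitary.schrodingerL2` at `β_{𝕋_v}`, `ψ_v`), extending the tree's
  `localSchrodinger` (`localSchrodingerL2_apply_toLp`), unitary, central character `ψ_v` (`localSchrodingerL2_ofCenter`),
  IRREDUCIBLE (`localSchrodingerL2_irreducible`: closed invariant subspaces are `⊥`/`⊤`; scalar commutant
  `hasScalarCommutant_localSchrodingerL2` — the tree's `L²` Stone–von Neumann files via `HeisenbergGroup/SchrodingerL2Irreducible`);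
  **`LocalMpL2`** `:= MpPsi (localSchrodingerL2 …)` — the group of pairs `(g, M)`, `g ∈ Sp(𝕎_v)`, `M ∈ GL(L²(F_vᴺ))` with
  `M ρ_{ψ_v}(h) = ρ_{ψ_v}(g h) M`;
* §2 for every local splitting datum `D` with `|β| = 1`: **`D.localSplittingL2 hβ μ' : U(J)(F_v) →* LocalMpL2 …`**,
  `g ↦ (ι_v g, U_g)` with `U_g = D.localOmegaL2 hβ μ' g` the UNITARY extension of `ω_v(g) = β(g)⁻¹ r(ι_v g)`
  (`LocalWeilRepresentationL2Unitary.lean`); it is a homomorphism over `ι_v` (`proj_localSplittingL2`) whose operators are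
  unitary (`norm_toRep_localSplittingL2_apply`), strongly continuous (`continuous_toRep_localSplittingL2_apply`) and extend
  `ω_v` (`toRep_localSplittingL2_apply_toLp`);
* §3 the CM datum of a CM field `L` (Kudla's `β = χ_w(det)`-splitting with `χ` a unitary Hecke character,
  `|β| = 1` by `norm_beta_localSplittingDatumCM_eq_one`): the unconditional instance **`exists_localSplittingL2_CM`**.

So, at every finite place, `(L²(F_vᴺ), ρ_{ψ_v})` is an irreducible unitary representation of `H(𝕎_v)` with central
character `ψ_v` in the printed sense, and "`π_v` splits over `U(J)(F_v)`" holds in the tree for THIS model with an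
explicit, strongly continuous, unitary splitting — the local clause behind [GelbartRogawski1991, Prop. 3.1.1] in its
printed Hilbert-space form.  What this does NOT give: the printed proposition quantifies over EVERY irreducible unitary
`ρ_ψ` (unique up to isomorphism — the uniqueness half of Stone–von Neumann, not formalised here) and is GLOBAL (adelic);
`Prop311AsPrinted` is untouched and nothing of the cited sources is asserted.  HC_CM is not touched.

## References
* [GelbartRogawski1991] S. Gelbart, J. Rogawski, Invent. Math. 105 (1991) 445–472, §3.1 pp. 454–455.
* [Weil1964] A. Weil, Acta Math. 111 (1964) 143–211, Chap. I n° 11–13.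
* [MoeglinVignerasWaldspurger1987] C. Mœglin, M.-F. Vignéras, J.-L. Waldspurger, LNM 1291 (1987), Chap. 2 II.1.
* [Kudla1994] S. S. Kudla, Israel J. Math. 87 (1994) 361–401, Thm 3.1.
-/

set_option autoImplicit false

noncomputable section

open NumberField IsDedekindDomain _root_.MeasureTheory Matrix
open Literature.RepresentationTheory.HeisenbergGroup
open Literature.NumberTheory.Automorphic Literature.NumberTheory.Weil1964
open Literature.NumberTheory.GaloisRepresentations Literature.RepresentationTheory.HarrisKudlaSweet1996
open Literature.NumberTheory.GaloisRepresentations.IsNonarchimedeanLocalField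

namespace Literature.NumberTheory.GelbartRogawski1991.UnitaryDualPair.LocalSplitting

/-! ## §1 The unitary Schrödinger representation of `H(𝕎_v)` on `L²(F_vᴺ)` and its group of pairs -/

section Schrodinger

variable (F : Type) [Field F] [NumberField F] (N : ℕ) (T : Matrix (Fin N) (Fin N) F) (v : HeightOneSpectrum (𝓞 F))
  [MeasurableSpace (v.adicCompletion F)] [BorelSpace (v.adicCompletion F)]
  (μ' : Measure (v.adicCompletion F)) [μ'.IsAddHaarMeasure]

/-- **the UNITARY Schrödinger representation `ρ_{ψ_v}` of `H(𝕎_v)` on `L²(F_vᴺ, μ'ᴺ)`** (`ψ_v = adeleAddCharAt F v`,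
Gram matrix `𝕋_v`): the unitary extension of the tree's smooth model `localSchrodinger F N T v`.
[cite: GelbartRogawski1991, §3.1 p. 454 L19–21, L28–29] [cite: Weil1964, Chap. I n° 11–13] -/
def localSchrodingerL2 :
    Representation ℂ (Heisenberg (polar (localPairing F N T v))) (Lp ℂ 2 (Measure.pi fun _ : Fin N => μ')) := by
  haveI := secondCountableTopology_adicCompletion F v
  exact schrodingerL2 (localPairing F N T v) (adeleAddCharAt F v)
    (isLocallyConstant_of_isContinuousNontrivial (isContinuousNontrivial_adeleAddCharAt F v))
    (continuous_toLinearMap₂'_left (localGram F N T v)) (Measure.pi fun _ : Fin N => μ')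
    (SchwartzBruhat.denseRange_toLp_adicCompletionPi F v N μ')

/-- **`ρ_{ψ_v}` on `L²` extends the smooth model**: `ρ_{ψ_v}(h) [Φ] = [localSchrodinger h Φ]`.
[cite: MoeglinVignerasWaldspurger1987, Chap. 2 I.4 Exemple (1)] -/
theorem localSchrodingerL2_apply_toLp (h : Heisenberg (polar (localPairing F N T v)))
    (Φ : SchwartzBruhat (Fin N → v.adicCompletion F)) :
    haveI := secondCountableTopology_adicCompletion F v
    localSchrodingerL2 F N T v μ' h (SchwartzBruhat.toLp (Measure.pi fun _ : Fin N => μ') Φ) =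
      SchwartzBruhat.toLp (Measure.pi fun _ : Fin N => μ') (localSchrodinger F N T v h Φ) := by
  haveI := secondCountableTopology_adicCompletion F v
  exact schrodingerL2_apply_toLp _ _ _ _ _ _ h Φ

/-- unitarity of `ρ_{ψ_v}` on `L²(F_vᴺ)`. [cite: GelbartRogawski1991, §3.1 p. 454 L19–21] -/
theorem norm_localSchrodingerL2_apply (h : Heisenberg (polar (localPairing F N T v)))
    (f : Lp ℂ 2 (Measure.pi fun _ : Fin N => μ')) : ‖localSchrodingerL2 F N T v μ' h f‖ = ‖f‖ := by
  haveI := secondCountableTopology_adicCompletion F v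
  exact norm_schrodingerL2_apply _ _ _ _ _ _ h f

/-- **central character `ψ_v`** of `ρ_{ψ_v}` on `L²(F_vᴺ)`. [cite: GelbartRogawski1991, §3.1 p. 454 L19–21] -/
theorem localSchrodingerL2_ofCenter (t : v.adicCompletion F) (f : Lp ℂ 2 (Measure.pi fun _ : Fin N => μ')) :
    localSchrodingerL2 F N T v μ' (Heisenberg.ofCenter (polar (localPairing F N T v)) (Multiplicative.ofAdd t)) f =
      ((adeleAddCharAt F v t : Circle) : ℂ) • f := by
  haveI := secondCountableTopology_adicCompletion F v
  exact schrodingerL2_ofCenter _ _ _ _ _ _ t f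

/-- **scalar commutant of `ρ_{ψ_v}` on `L²(F_vᴺ)`**: every bounded operator commuting with all `ρ_{ψ_v}(h)` is a scalar
(`HeisenbergGroup/SchrodingerL2Irreducible.lean` at `F_v`, `𝕋_v` invertible). [cite: MoeglinVignerasWaldspurger1987, Chap. 2 I.2–I.3] -/
theorem hasScalarCommutant_localSchrodingerL2 (hTd : IsUnit T.det) :
    SchrodingerLevi.HasScalarCommutant (Lp ℂ 2 (Measure.pi fun _ : Fin N => μ'))
      (Set.range fun h : Heisenberg (polar (localPairing F N T v)) => ⇑(localSchrodingerL2 F N T v μ' h)) := by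
  haveI := secondCountableTopology_adicCompletion F v
  haveI : ProperSpace (v.adicCompletion F) := properSpace_adicCompletion F v
  have hdet : IsUnit (localGram F N T v).det := by
    have h := hTd.map (algebraMap F (v.adicCompletion F))
    rwa [RingHom.map_det, RingHom.mapMatrix_apply] at h
  exact hasScalarCommutant_schrodingerL2 (localGram F N T v) (adeleAddCharAt F v)
    (isLocallyConstant_of_isContinuousNontrivial (isContinuousNontrivial_adeleAddCharAt F v)) (Measure.pi fun _ : Fin N => μ')
    (SchwartzBruhat.denseRange_toLp_adicCompletionPi F v N μ') (continuous_adeleAddCharAt F v) hdet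
    (exists_adeleAddCharAt_ne_one F v)

/-- **`ρ_{ψ_v}` on `L²(F_vᴺ)` is an IRREDUCIBLE unitary representation** (closed invariant subspaces are `⊥` or `⊤`) — with
`localSchrodingerL2_ofCenter` and `norm_localSchrodingerL2_apply`, the tree's `(L²(F_vᴺ), ρ_{ψ_v})` is "an irreducible
unitary representation of `H(W)` with central character `ψ`" in the printed sense, at the finite place `v`.
[cite: GelbartRogawski1991, §3.1 p. 454 L19–21] [cite: MoeglinVignerasWaldspurger1987, Chap. 2 I.2–I.3] -/
theorem localSchrodingerL2_irreducible (hTd : IsUnit T.det) (K : Submodule ℂ (Lp ℂ 2 (Measure.pi fun _ : Fin N => μ')))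
    (hKc : IsClosed (K : Set (Lp ℂ 2 (Measure.pi fun _ : Fin N => μ'))))
    (hK : ∀ (h : Heisenberg (polar (localPairing F N T v))), ∀ f ∈ K, localSchrodingerL2 F N T v μ' h f ∈ K) :
    K = ⊥ ∨ K = ⊤ := by
  haveI := secondCountableTopology_adicCompletion F v
  haveI : ProperSpace (v.adicCompletion F) := properSpace_adicCompletion F v
  have hdet : IsUnit (localGram F N T v).det := by
    have h := hTd.map (algebraMap F (v.adicCompletion F))
    rwa [RingHom.map_det, RingHom.mapMatrix_apply] at h
  exact schrodingerL2_irreducible (localGram F N T v) (adeleAddCharAt F v)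
    (isLocallyConstant_of_isContinuousNontrivial (isContinuousNontrivial_adeleAddCharAt F v)) (Measure.pi fun _ : Fin N => μ')
    (SchwartzBruhat.denseRange_toLp_adicCompletionPi F v N μ') (continuous_adeleAddCharAt F v) hdet
    (exists_adeleAddCharAt_ne_one F v) K hKc hK

/-- **`Mp_v(W)` in the printed form**: the group of pairs `(g, M)`, `g ∈ Sp(𝕎_v)`, `M ∈ GL(L²(F_vᴺ))`, with
`M ρ_{ψ_v}(h) = ρ_{ψ_v}(g h) M` (the tree's `MpPsi` of the UNITARY model). [cite: GelbartRogawski1991, §3.1 p. 454 L21–29] -/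
abbrev LocalMpL2 : Type := MpPsi (localSchrodingerL2 F N T v μ')

end Schrodinger

/-! ## §2 The local splitting into `LocalMpL2` -/

section Datum

variable {F : Type} [Field F] [NumberField F] {E : Type} [Field E] [NumberField E] [Algebra F E]
  [Algebra.IsQuadraticExtension F E] {c : E ≃ₐ[F] E} {N : ℕ} {δ : E} {hcδ : c δ = -δ} {hδ : δ ≠ 0} {d : F}
  {hd : δ * δ = algebraMap F E d} {T : Matrix (Fin N) (Fin N) F} {hT : T.IsSymm} {hTd : IsUnit T.det}
  {J : Matrix (Fin N) (Fin N) E} {hJ : J = T.map (algebraMap F E)} {v : HeightOneSpectrum (𝓞 F)}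
  [MeasurableSpace (v.adicCompletion F)] [BorelSpace (v.adicCompletion F)]
  {μ : Measure (v.adicCompletion F)} [μ.IsAddHaarMeasure]
  {ℓ : Submodule (v.adicCompletion F) ((Fin N → v.adicCompletion F) × (Fin N → v.adicCompletion F))}
  {hℓ : LinearMap.BilinForm.orthogonal (alt (polar (localPairing F N T v))) ℓ = ℓ}
  (D : LocalSplittingDatum F E c N hcδ hδ hd T hT hTd hJ v μ ℓ hℓ)
  (hβ : ∀ g : UnitaryGroup.localPi E c N J v, ‖((D.beta g : ℂˣ) : ℂ)‖ = 1)
  (μ' : Measure (v.adicCompletion F)) [μ'.IsAddHaarMeasure]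

/-- **the unitary pair of `g ∈ U(J)(F_v)`**: `(ι_v g, U_g) ∈ Mp_v(W)` over `L²(F_vᴺ)`, `U_g = D.localOmegaL2 hβ μ' g` — the
relation `U_g ρ_{ψ_v}(h) U_g⁻¹ = ρ_{ψ_v}(ι_v(g) h)` holds on the Hilbert space because it holds on the dense smooth model
for the pair `s_v(g) = (ι_v g, β(g)⁻¹ r(ι_v g))`. [cite: GelbartRogawski1991, §3.1 p. 454 L21–24, Prop. 3.1.1 p. 455 L1] -/
theorem LocalSplittingDatum.iota_localOmegaL2_mem (g : UnitaryGroup.localPi E c N J v) :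
    (iota F E c N hcδ hδ hd T hT hJ v g, (D.localOmegaL2 hβ μ' g).toLinearEquiv) ∈ MpPsi (localSchrodingerL2 F N T v μ') := by
  haveI := secondCountableTopology_adicCompletion F v
  have hp : (D.localSplitting g).1 ∈ MpPsi (localSchrodinger F N T v) := (D.localSplitting g).2
  have h1 : (D.localSplitting g).1.1 = iota F E c N hcδ hδ hd T hT hJ v g := D.proj_localSplitting g
  have key := mem_MpPsi_schrodingerL2_of_mem (localPairing F N T v) (adeleAddCharAt F v)
    (isLocallyConstant_of_isContinuousNontrivial (isContinuousNontrivial_adeleAddCharAt F v))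
    (continuous_toLinearMap₂'_left (localGram F N T v)) (Measure.pi fun _ : Fin N => μ')
    (SchwartzBruhat.denseRange_toLp_adicCompletionPi F v N μ') (D.isL2Isometric_localOmega_of_norm_beta μ' hβ) g hp
    (fun Φ => rfl)
  rw [h1] at key
  exact key

/-- **THE LOCAL SPLITTING IN THE UNITARY MODEL**: `s_v : U(J)(F_v) →* Mp_v(W)` over `L²(F_vᴺ, μ'ᴺ)`, `g ↦ (ι_v g, U_g)`,
for any local splitting datum with `|β| = 1`. [cite: GelbartRogawski1991, §3.1 Prop. 3.1.1 p. 455 L1–3] -/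
def LocalSplittingDatum.localSplittingL2 : UnitaryGroup.localPi E c N J v →* LocalMpL2 F N T v μ' where
  toFun g := ⟨(iota F E c N hcδ hδ hd T hT hJ v g, (D.localOmegaL2 hβ μ' g).toLinearEquiv), D.iota_localOmegaL2_mem hβ μ' g⟩
  map_one' := by
    apply Subtype.ext
    refine Prod.ext (map_one _) ?_
    show (D.localOmegaL2 hβ μ' 1).toLinearEquiv = 1
    rw [map_one]
    rfl
  map_mul' g g' := by
    apply Subtype.ext
    refine Prod.ext (map_mul _ g g') ?_
    show (D.localOmegaL2 hβ μ' (g * g')).toLinearEquiv =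
      (D.localOmegaL2 hβ μ' g).toLinearEquiv * (D.localOmegaL2 hβ μ' g').toLinearEquiv
    rw [map_mul]
    rfl

/-- **`π_v ∘ s_v = ι_v`**: the unitary splitting lies over the embedding `U(J)(F_v) → Sp(𝕎_v)`.
[cite: GelbartRogawski1991, §3.1 Prop. 3.1.1 p. 455 L1] -/
theorem LocalSplittingDatum.proj_localSplittingL2 (g : UnitaryGroup.localPi E c N J v) :
    MpPsi.proj _ (D.localSplittingL2 hβ μ' g) = iota F E c N hcδ hδ hd T hT hJ v g := rfl

/-- the operator of `s_v(g)` is `U_g = localOmegaL2 g`. [cite: GelbartRogawski1991, §3.1 p. 454 L24–25] -/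
theorem LocalSplittingDatum.toRep_localSplittingL2_apply (g : UnitaryGroup.localPi E c N J v)
    (f : Lp ℂ 2 (Measure.pi fun _ : Fin N => μ')) :
    MpPsi.toRep _ (D.localSplittingL2 hβ μ' g) f = D.localOmegaL2 hβ μ' g f := rfl

/-- the operator `M_g` of the pair `s_v(g) = (ι_v g, M_g)` is a BOUNDED operator with bounded inverse ("operator on the
space of `ρ_ψ`" in the printed sense; rendering R4 of the tree's `Prop311AsPrinted`: `M` and `M⁻¹` continuous).
[cite: GelbartRogawski1991, §3.1 p. 454 L21–24] -/
theorem LocalSplittingDatum.continuous_toOp_localSplittingL2 (g : UnitaryGroup.localPi E c N J v) :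
    Continuous (MpPsi.toOp _ (D.localSplittingL2 hβ μ' g)) ∧ Continuous (MpPsi.toOp _ (D.localSplittingL2 hβ μ' g)).symm :=
  ⟨(D.localOmegaL2 hβ μ' g).continuous, (D.localOmegaL2 hβ μ' g).symm.continuous⟩

/-- **`ω_ψ ∘ s_v` is unitary**: `‖U_g f‖ = ‖f‖`. [cite: GelbartRogawski1991, §3.1 p. 454 L24–25] -/
theorem LocalSplittingDatum.norm_toRep_localSplittingL2_apply (g : UnitaryGroup.localPi E c N J v)
    (f : Lp ℂ 2 (Measure.pi fun _ : Fin N => μ')) : ‖MpPsi.toRep _ (D.localSplittingL2 hβ μ' g) f‖ = ‖f‖ :=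
  D.norm_localOmegaL2_apply hβ μ' g f

/-- **`ω_ψ ∘ s_v` is strongly continuous**: `g ↦ U_g f` is continuous for every `f ∈ L²(F_vᴺ)`.
[cite: GelbartRogawski1991, §3.1 Prop. 3.1.1 p. 455 L1–2] -/
theorem LocalSplittingDatum.continuous_toRep_localSplittingL2_apply (f : Lp ℂ 2 (Measure.pi fun _ : Fin N => μ')) :
    Continuous fun g : UnitaryGroup.localPi E c N J v => MpPsi.toRep _ (D.localSplittingL2 hβ μ' g) f :=
  D.continuous_localOmegaL2_apply hβ μ' f

/-- **`ω_ψ ∘ s_v` extends the smooth Weil representation**: `U_g [Φ] = [ω_v(g) Φ]` for `Φ ∈ 𝒮(F_vᴺ)`.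
[cite: MoeglinVignerasWaldspurger1987, Chap. 2 II.1] -/
theorem LocalSplittingDatum.toRep_localSplittingL2_apply_toLp (g : UnitaryGroup.localPi E c N J v)
    (Φ : SchwartzBruhat (Fin N → v.adicCompletion F)) :
    haveI := secondCountableTopology_adicCompletion F v
    MpPsi.toRep _ (D.localSplittingL2 hβ μ' g) (SchwartzBruhat.toLp (Measure.pi fun _ : Fin N => μ') Φ) =
      SchwartzBruhat.toLp (Measure.pi fun _ : Fin N => μ') (D.localOmega g Φ) :=
  D.localOmegaL2_apply_toLp hβ μ' g Φ

end Datum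

/-! ## §3 The CM datum: an unconditional instance -/

section CM

variable (L : Type) [Field L] [NumberField L] [IsCMField L] (n : ℕ) {T₀ : Matrix (Fin n) (Fin n) (maximalRealSubfield L)}
  (hT₀ : T₀.IsSymm) (hT₀d : IsUnit T₀.det) (χ : HeckeCharacter L) (hχ : IsSplittingChar L 1 χ)
  (v : HeightOneSpectrum (𝓞 (maximalRealSubfield L)))
  [MeasurableSpace (v.adicCompletion (maximalRealSubfield L))] [BorelSpace (v.adicCompletion (maximalRealSubfield L))]
  (μ : Measure (v.adicCompletion (maximalRealSubfield L))) [μ.IsAddHaarMeasure]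
  (μ' : Measure (v.adicCompletion (maximalRealSubfield L))) [μ'.IsAddHaarMeasure]

/-- **the doubled CM datum splits `π_v` over `U(T₀ ⊕ −T₀)(L⁺_v)` in the unitary model `L²((L⁺_v)^{n+n})`**, unconditionally
(`χ` a unitary Hecke character of `L` with `χ|_{𝔸_{L⁺}} = ε_{L/L⁺}`; Kudla's `β` has `|β| = 1`): a homomorphism `s_v` into
`Mp_v(W)` over `ι_v` by unitary, strongly continuous operators extending `ω_v`.
[cite: GelbartRogawski1991, §3.1 Prop. 3.1.1 p. 455 L1–3] [cite: Kudla1994, Thm 3.1] -/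
theorem exists_localSplittingL2_CM (hχu : χ.IsUnitary) {JD : Matrix (Fin (n + n)) (Fin (n + n)) L}
    (hJD : JD = (gramD (maximalRealSubfield L) n T₀).map (algebraMap (maximalRealSubfield L) L)) :
    haveI := secondCountableTopology_adicCompletion (maximalRealSubfield L) v
    ∃ s : UnitaryGroup.localPi L (IsCMField.complexConj L) (n + n) JD v →*
        LocalMpL2 (maximalRealSubfield L) (n + n) (gramD (maximalRealSubfield L) n T₀) v μ',
      (∀ g, MpPsi.proj _ (s g) =
          iota (maximalRealSubfield L) L (IsCMField.complexConj L) (n + n) (complexConj_imagUnit L) (imagUnit_ne_zero L)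
            (imagUnit_mul_self L) (gramD (maximalRealSubfield L) n T₀) (gramD_isSymm (maximalRealSubfield L) n hT₀) hJD v g) ∧
      (∀ g f, ‖MpPsi.toRep _ (s g) f‖ = ‖f‖) ∧
      (∀ f, Continuous fun g => MpPsi.toRep _ (s g) f) ∧
      ∀ g (Φ : SchwartzBruhat (Fin (n + n) → v.adicCompletion (maximalRealSubfield L))),
        MpPsi.toRep _ (s g) (SchwartzBruhat.toLp (Measure.pi fun _ : Fin (n + n) => μ') Φ) =
          SchwartzBruhat.toLp (Measure.pi fun _ : Fin (n + n) => μ')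
            ((localSplittingDatumCM L v μ n hT₀ hT₀d hJD χ hχ).localOmega g Φ) := by
  haveI := secondCountableTopology_adicCompletion (maximalRealSubfield L) v
  have hβ : ∀ g, ‖(((localSplittingDatumCM L v μ n hT₀ hT₀d hJD χ hχ).beta g : ℂˣ) : ℂ)‖ = 1 :=
    norm_beta_localSplittingDatumCM_eq_one n L v μ hT₀ hT₀d hJD χ hχ hχu
  refine ⟨(localSplittingDatumCM L v μ n hT₀ hT₀d hJD χ hχ).localSplittingL2 hβ μ', fun g => ?_, fun g f => ?_, fun f => ?_,
    fun g Φ => ?_⟩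
  · exact (localSplittingDatumCM L v μ n hT₀ hT₀d hJD χ hχ).proj_localSplittingL2 hβ μ' g
  · exact (localSplittingDatumCM L v μ n hT₀ hT₀d hJD χ hχ).norm_toRep_localSplittingL2_apply hβ μ' g f
  · exact (localSplittingDatumCM L v μ n hT₀ hT₀d hJD χ hχ).continuous_toRep_localSplittingL2_apply hβ μ' f
  · exact (localSplittingDatumCM L v μ n hT₀ hT₀d hJD χ hχ).toRep_localSplittingL2_apply_toLp hβ μ' g Φ

end CM

end Literature.NumberTheory.GelbartRogawski1991.UnitaryDualPair.LocalSplitting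

end
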